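import Summits.AnomalousDissipation.AnomalousDissipation.Theses.TameRoughRigidity

/-!
# `TameRoughRigidity.Assembly` (stmt-AnomalousDissipation-18626): proof

`Summit.AnomalousDissipation.AnomalousDissipation.Theses.TameRoughRigidity.Assembly` is the assembly
item of route `AnomalousDissipation/TameRoughRigidity` (rev 2):
`GPEulerCoercive → TameClosure → TameToRough → GPMeanBoundedFamily → ResidualTransferSSS →
EnsembleFloorTransfer → AnomalousDissipation`.
Its body is, verbatim, the type of the route's planner-authored deciding theorem
`Summit.AnomalousDissipation.AnomalousDissipation.Theses.TameRoughRigidity.closes` (D-0027 §2.1,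
sorry-free in the route file, standard axioms): the typed split N → K → R → X
(`GPEulerCoercive`, `TameClosure`, `TameToRough` give the parent leaf
`EnsembleRigidity.GPStatisticalRigidity` by contraposition of the closure lemma, the conditional
calibration's own threshold `G₁(E)`, and the vacuity patch `δ₀' = min δ₀ (r/2)`), followed by the
parent route's certified glue `EnsembleRigidity.closes` applied to that leaf and the three remaining
hypotheses (`GPMeanBoundedFamily` and the two landed bridge supports `ResidualTransferSSS`,
`EnsembleFloorTransfer`).
So the assembly is settled by re-applying `closes` after unfolding the definition; nothing else is
proved here (the six hypotheses are the route's own items).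
Sources of the route step: Foias–Manley–Rosa–Temam 2001 Ch. IV (statistical solutions),
Doering–Foias 2002 §2–3.
-/

-- `Summit.<Summit>.<Problem>` is the tree's mandated summit-side namespace (CONVENTIONS §2); for this
-- single-conjunct summit the two coincide, so the duplicate is deliberate.
set_option linter.dupNamespace false

namespace Summit.AnomalousDissipation.AnomalousDissipation.Theorems

/-- **Assembly of route `TameRoughRigidity`** (item stmt-AnomalousDissipation-18626):
`GPEulerCoercive → TameClosure → TameToRough → GPMeanBoundedFamily → ResidualTransferSSS →
EnsembleFloorTransfer → AnomalousDissipation`.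
Proof: the statement unfolds to the type of the route's deciding theorem
`Summit.AnomalousDissipation.AnomalousDissipation.Theses.TameRoughRigidity.closes`, which is applied
to the six hypotheses. [route AnomalousDissipation/TameRoughRigidity; FoiasManleyRosaTemam2001;
DoeringFoias2002] -/
theorem tameRoughRigidity_assembly_proof :
    Summit.AnomalousDissipation.AnomalousDissipation.Theses.TameRoughRigidity.Assembly := by
  unfold Summit.AnomalousDissipation.AnomalousDissipation.Theses.TameRoughRigidity.Assembly
  intro hN hK hR hFam hRes hFloor
  exact Summit.AnomalousDissipation.AnomalousDissipation.Theses.TameRoughRigidity.closes hN hK hR hFam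
    hRes hFloor

end Summit.AnomalousDissipation.AnomalousDissipation.Theorems
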